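import Mathlib
import HarnessLib

/-!
# QUANT lane R8 — second occurring weight of independent items (I): recursions, basic bounds, and the regime `Σ w p ≥ 1`

builds on p205010 (kernel theorem, internal audit signed; external expert review pending)

Support file (`--supports stmt-CriticalPhenomena-4575`), QUANT lane lead (gen 8), rung R8 of
`run/shared/lean/prim/quant/LADDER.md`; memo `prim-quant-lead-g7/LEAD-NOTES-G7.md` N16/N17 (Step 2b) — part of the elementary core of
"FAR holds at layer one on every tree" (companion `…QuantSecondWeightSingles.lean`: Lemma T′ and the convexity reduction; tree files
`…QuantSecondWeightLevels.lean`, `…QuantFarTreeMultiCompanion.lean`).  Pure real algebra on lists; no probability space, no definitions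
(local notations for `List.foldr` expressions), no sorries, standard axioms.

**Setting.**  A finite list of ITEMS `(w, p)` (weight `w`, occurrence probability `p`), read in list order; `x > 0` a base level.  The items
occur independently; `W` is the weight of the SECOND occurring item in list order, `x` if exactly one item occurs, `0` if none (with the items
listed heaviest first this is the law-free skeleton of "at least two relays of a tree are reached", N17 Step 1).  Everything is expressed through
structural recursions:
* `EFS[L, x] = (E W, E F)` where `F` = weight of the FIRST occurring item or `x`:  `E W(l :: L) = p·F(L) + (1−p)·E W(L)`,
  `F(l :: L) = w p + (1−p) F(L)`, `E W([]) = 0`, `F([]) = x`;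
* `zS[L] = ∏ (1 − p)` (nothing occurs), `σS[L] = Σ w p` (expected occurring weight);
* `BD[L, x] = (B, D)`, `D = Σ (w − x)·u`, `B = Σ_k (w_k − x) u_k (u_1 + ⋯ + u_{k−1})` in odds `u = p/(1−p)`.
An item is ADMISSIBLE at level `x` (`Adm[x, l]`) when `0 ≤ p ≤ 1`, `w ≤ 1` and `x ≤ w p` (hence `x ≤ w`, `x ≤ p`).

* `Quant.SecondWeight.ew_ge_x_mul` — (E0) `E W ≥ x (1 − zS)`;  `f_sub_x_ge` — (F1) `F − x ≥ zS·D`;  `ew_sub_x_ge` — (E1) `E W − x ≥ zS·(B − x)`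
  (the pairwise disjoint events "item `k` is the second to occur" carry `W = w_k`);
* `Quant.SecondWeight.ew_ge_of_sigma_ge_one` — **regime `σ ≥ 1`** (N17 Step 2b): admissible items with `Σ w p ≥ 1` give `E W ≥ x`,
  via `B ≥ u_1·D(tail) ≥ u_1 (1 − w_1 p_1) ≥ w_1 p_1 ≥ x` (`b_ge_x`), or (E0) if some item is sure.
No order hypothesis is needed for these list inequalities.  Exact numerical re-check of every displayed step: lead g8,
`work/explore/check_abstract.py` (3 000 random rational instances, 0 violations).  Nearest prior art searched (corpus hybrid/vsearch + galaxy,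
2026-08-20: "second largest order statistic independent Bernoulli weights", "prophet inequality second maximum", "Poisson binomial exactly one
success"): nothing giving these bounds; [this work].
-/

namespace Summit.CriticalPhenomena.PercolationContinuityZ3.Theorems

namespace Quant

namespace SecondWeight

open Finset

/-- `zS[L] = ∏_{(w,p) ∈ L} (1 − p)`: no item occurs. -/
local notation3 "zS[" L "]" => (List.foldr (fun (l : ℝ × ℝ) (acc : ℝ) => (1 - l.2) * acc) (1 : ℝ) L)
/-- `EFS[L, x] = (E W, E F)`: expected second occurring weight (`x` if exactly one, `0` if none) and expected first occurring weight (`x` if none). -/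
local notation3 "EFS[" L ", " x "]" =>
  (List.foldr (fun (l : ℝ × ℝ) (acc : ℝ × ℝ) => (l.2 * acc.2 + (1 - l.2) * acc.1, l.1 * l.2 + (1 - l.2) * acc.2)) ((0 : ℝ), (x : ℝ)) L)
/-- `σS[L] = Σ w p`: expected total occurring weight. -/
local notation3 "σS[" L "]" => (List.sum (List.map (fun (l : ℝ × ℝ) => l.1 * l.2) L))
/-- `BD[L, x] = (B, D)`: the odds functionals of regime 2b, `D = Σ (w − x) u`, `B = Σ_k (w_k − x) u_k U_{k−1}`, `u = p/(1−p)`. -/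
local notation3 "BD[" L ", " x "]" =>
  (List.foldr (fun (l : ℝ × ℝ) (acc : ℝ × ℝ) => (acc.1 + l.2 / (1 - l.2) * acc.2, (l.1 - x) * (l.2 / (1 - l.2)) + acc.2))
    ((0 : ℝ), (0 : ℝ)) L)
/-- admissible item at level `x`: `0 ≤ p ≤ 1`, `w ≤ 1`, `x ≤ w p`. -/
local notation3 "Adm[" x ", " l "]" => (0 ≤ (l : ℝ × ℝ).2 ∧ (l : ℝ × ℝ).2 ≤ 1 ∧ (l : ℝ × ℝ).1 ≤ 1 ∧ (x : ℝ) ≤ (l : ℝ × ℝ).1 * (l : ℝ × ℝ).2)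

variable {x : ℝ}

/-! ### Admissible items -/

/-- An admissible item at a positive level has positive weight, and `x ≤ w`, `x ≤ p`. [this work] -/
theorem adm_bounds (hx : 0 < x) {l : ℝ × ℝ} (h : Adm[x, l]) : 0 < l.1 ∧ x ≤ l.1 ∧ x ≤ l.2 := by
  obtain ⟨hp0, hp1, hw1, hwp⟩ := h
  have hw0 : 0 < l.1 := by
    by_contra hneg
    push Not at hneg
    have : l.1 * l.2 ≤ 0 := mul_nonpos_of_nonpos_of_nonneg hneg hp0
    linarith
  refine ⟨hw0, ?_, ?_⟩
  · nlinarith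
  · nlinarith

/-! ### The recursions -/

/-- `zS` of a cons. -/
theorem zS_cons (l : ℝ × ℝ) (L : List (ℝ × ℝ)) : zS[l :: L] = (1 - l.2) * zS[L] := rfl

/-- `EFS` of a cons. -/
theorem EFS_cons (l : ℝ × ℝ) (L : List (ℝ × ℝ)) (x : ℝ) :
    EFS[l :: L, x] = (l.2 * (EFS[L, x]).2 + (1 - l.2) * (EFS[L, x]).1, l.1 * l.2 + (1 - l.2) * (EFS[L, x]).2) := rfl


/-- `BD` of a cons. -/
theorem BD_cons (l : ℝ × ℝ) (L : List (ℝ × ℝ)) (x : ℝ) :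
    BD[l :: L, x] = ((BD[L, x]).1 + l.2 / (1 - l.2) * (BD[L, x]).2, (l.1 - x) * (l.2 / (1 - l.2)) + (BD[L, x]).2) := rfl

/-- `σS` of a cons. -/
theorem σS_cons (l : ℝ × ℝ) (L : List (ℝ × ℝ)) : σS[l :: L] = l.1 * l.2 + σS[L] := by
  simp only [List.map_cons, List.sum_cons]

/-- `σS` of an append. -/
theorem σS_append (L M : List (ℝ × ℝ)) : σS[L ++ M] = σS[L] + σS[M] := by
  simp only [List.map_append, List.sum_append]

/-! ### Basic bounds -/

/-- `0 ≤ zS ≤ 1` for probabilities in `[0,1]`. [this work] -/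
theorem zS_bounds (L : List (ℝ × ℝ)) (hL : ∀ l ∈ L, 0 ≤ l.2 ∧ l.2 ≤ 1) : 0 ≤ zS[L] ∧ zS[L] ≤ 1 := by
  induction L with
  | nil => simp
  | cons l L ih =>
    have hl := hL l (by simp)
    have ih' := ih (fun l' hl' => hL l' (by simp [hl']))
    rw [zS_cons]
    constructor
    · exact mul_nonneg (by linarith) ih'.1
    · nlinarith [ih'.1, ih'.2, hl.1, hl.2]

/-- A sure item (`p = 1`) kills `zS`. [this work] -/
theorem zS_eq_zero_of_mem (L : List (ℝ × ℝ)) {l : ℝ × ℝ} (hl : l ∈ L) (hp : l.2 = 1) : zS[L] = 0 := by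
  induction L with
  | nil => simp at hl
  | cons l' L ih =>
    rw [zS_cons]
    rcases List.mem_cons.1 hl with rfl | h
    · rw [hp]; ring
    · rw [ih h]; ring

/-- `σS ≥ 0` for admissible items. [this work] -/
theorem σS_nonneg (L : List (ℝ × ℝ)) (hL : ∀ l ∈ L, 0 ≤ l.2 ∧ 0 ≤ l.1 * l.2) : 0 ≤ σS[L] := by
  induction L with
  | nil => simp
  | cons l L ih =>
    rw [σS_cons]
    have := hL l (by simp)
    have := ih (fun l' hl' => hL l' (by simp [hl']))
    linarith

/-- `F ≥ x` and `E W ≥ 0` (items with `0 ≤ p ≤ 1`, `x ≤ w`, `0 ≤ x`). [this work] -/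
theorem EFS_lower (hx : 0 ≤ x) (L : List (ℝ × ℝ)) (hL : ∀ l ∈ L, 0 ≤ l.2 ∧ l.2 ≤ 1 ∧ x ≤ l.1) :
    0 ≤ (EFS[L, x]).1 ∧ x ≤ (EFS[L, x]).2 := by
  induction L with
  | nil => simp
  | cons l L ih =>
    have hl := hL l (by simp)
    have ih' := ih (fun l' hl' => hL l' (by simp [hl']))
    rw [EFS_cons]
    constructor
    · show 0 ≤ l.2 * (EFS[L, x]).2 + (1 - l.2) * (EFS[L, x]).1
      have : 0 ≤ (EFS[L, x]).2 := le_trans hx ih'.2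
      nlinarith [ih'.1, hl.1, hl.2.1]
    · show x ≤ l.1 * l.2 + (1 - l.2) * (EFS[L, x]).2
      nlinarith [ih'.2, hl.1, hl.2.1, hl.2.2]

/-- `F ≤ 1` and `E W ≤ 1` (items with `0 ≤ p ≤ 1`, `w ≤ 1`, `0 ≤ x ≤ 1`). [this work] -/
theorem EFS_upper (hx : 0 ≤ x) (hx1 : x ≤ 1) (L : List (ℝ × ℝ)) (hL : ∀ l ∈ L, 0 ≤ l.2 ∧ l.2 ≤ 1 ∧ l.1 ≤ 1 ∧ x ≤ l.1) :
    (EFS[L, x]).1 ≤ 1 ∧ (EFS[L, x]).2 ≤ 1 := by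
  induction L with
  | nil => simp [hx1]
  | cons l L ih =>
    have hl := hL l (by simp)
    have ih' := ih (fun l' hl' => hL l' (by simp [hl']))
    have hlow := EFS_lower hx L (fun l' hl' => let h := hL l' (by simp [hl']); ⟨h.1, h.2.1, h.2.2.2⟩)
    rw [EFS_cons]
    constructor
    · show l.2 * (EFS[L, x]).2 + (1 - l.2) * (EFS[L, x]).1 ≤ 1
      nlinarith [ih'.1, ih'.2, hl.1, hl.2.1]
    · show l.1 * l.2 + (1 - l.2) * (EFS[L, x]).2 ≤ 1
      nlinarith [ih'.2, hl.1, hl.2.1, hl.2.2.1]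

/-- **(E0)** `E W ≥ x·(1 − zS)`: whenever something occurs, `W ≥ x`. [this work] -/
theorem ew_ge_x_mul (hx : 0 ≤ x) (L : List (ℝ × ℝ)) (hL : ∀ l ∈ L, 0 ≤ l.2 ∧ l.2 ≤ 1 ∧ x ≤ l.1) :
    x * (1 - zS[L]) ≤ (EFS[L, x]).1 := by
  induction L with
  | nil => simp
  | cons l L ih =>
    have hl := hL l (by simp)
    have hL' : ∀ l' ∈ L, 0 ≤ l'.2 ∧ l'.2 ≤ 1 ∧ x ≤ l'.1 := fun l' hl' => hL l' (by simp [hl'])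
    have ih' := ih hL'
    have hF := (EFS_lower hx L hL').2
    rw [EFS_cons, zS_cons]
    show x * (1 - (1 - l.2) * zS[L]) ≤ l.2 * (EFS[L, x]).2 + (1 - l.2) * (EFS[L, x]).1
    nlinarith [hl.1, hl.2.1]

/-! ### Regime `σ ≥ 1` (N17 Step 2b) -/

/-- `D ≥ σS` and `D ≥ 0`, `B ≥ 0` for admissible items with `p < 1`. [this work] -/
theorem BD_bounds (hx : 0 < x) (L : List (ℝ × ℝ)) (hL : ∀ l ∈ L, Adm[x, l] ∧ l.2 < 1) :
    0 ≤ (BD[L, x]).1 ∧ σS[L] ≤ (BD[L, x]).2 ∧ 0 ≤ (BD[L, x]).2 := by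
  induction L with
  | nil => simp
  | cons l L ih =>
    obtain ⟨hadm, hp1⟩ := hL l (by simp)
    have ih' := ih (fun l' hl' => hL l' (by simp [hl']))
    obtain ⟨hw0, hxw, hxp⟩ := adm_bounds hx hadm
    obtain ⟨hp0, _, hw1, hwp⟩ := hadm
    have h1p : 0 < 1 - l.2 := by linarith
    have hu0 : 0 ≤ l.2 / (1 - l.2) := div_nonneg hp0 h1p.le
    -- `(w − x)·u ≥ w p` since `w p ≥ x`
    have hkey : l.1 * l.2 ≤ (l.1 - x) * (l.2 / (1 - l.2)) := by
      rw [mul_div_assoc', le_div_iff₀ h1p]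
      nlinarith
    rw [BD_cons, σS_cons]
    refine ⟨?_, ?_, ?_⟩
    · show 0 ≤ (BD[L, x]).1 + l.2 / (1 - l.2) * (BD[L, x]).2
      nlinarith [ih'.1, ih'.2.2]
    · show l.1 * l.2 + σS[L] ≤ (l.1 - x) * (l.2 / (1 - l.2)) + (BD[L, x]).2
      linarith [ih'.2.1]
    · show 0 ≤ (l.1 - x) * (l.2 / (1 - l.2)) + (BD[L, x]).2
      nlinarith [ih'.2.2]

/-- **(F1)** `F − x ≥ zS · D` for admissible items with `p < 1`. [this work] -/
theorem f_sub_x_ge (hx : 0 < x) (L : List (ℝ × ℝ)) (hL : ∀ l ∈ L, Adm[x, l] ∧ l.2 < 1) :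
    zS[L] * (BD[L, x]).2 ≤ (EFS[L, x]).2 - x := by
  induction L with
  | nil => simp
  | cons l L ih =>
    obtain ⟨hadm, hp1⟩ := hL l (by simp)
    have hL' : ∀ l' ∈ L, Adm[x, l'] ∧ l'.2 < 1 := fun l' hl' => hL l' (by simp [hl'])
    have ih' := ih hL'
    obtain ⟨hw0, hxw, hxp⟩ := adm_bounds hx hadm
    obtain ⟨hp0, _, hw1, hwp⟩ := hadm
    have h1p : 0 < 1 - l.2 := by linarith
    have hz := zS_bounds L (fun l' hl' => ⟨(hL' l' hl').1.1, (hL' l' hl').1.2.1⟩)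
    have hD := (BD_bounds hx L hL').2.2
    rw [BD_cons, EFS_cons, zS_cons]
    show (1 - l.2) * zS[L] * ((l.1 - x) * (l.2 / (1 - l.2)) + (BD[L, x]).2) ≤
      l.1 * l.2 + (1 - l.2) * (EFS[L, x]).2 - x
    have hsimp : (1 - l.2) * zS[L] * ((l.1 - x) * (l.2 / (1 - l.2)) + (BD[L, x]).2) =
        zS[L] * (l.1 - x) * l.2 + (1 - l.2) * (zS[L] * (BD[L, x]).2) := by
      field_simp
    rw [hsimp]
    nlinarith [hz.1, hz.2, mul_le_mul_of_nonneg_left ih' h1p.le,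
      mul_nonneg (mul_nonneg (by linarith : 0 ≤ 1 - zS[L]) (by linarith : 0 ≤ l.1 - x)) hp0]

/-- **(E1)** `E W − x ≥ zS · (B − x)` for admissible items with `p < 1`. [this work] -/
theorem ew_sub_x_ge (hx : 0 < x) (L : List (ℝ × ℝ)) (hL : ∀ l ∈ L, Adm[x, l] ∧ l.2 < 1) :
    zS[L] * ((BD[L, x]).1 - x) ≤ (EFS[L, x]).1 - x := by
  induction L with
  | nil => simp
  | cons l L ih =>
    obtain ⟨hadm, hp1⟩ := hL l (by simp)
    have hL' : ∀ l' ∈ L, Adm[x, l'] ∧ l'.2 < 1 := fun l' hl' => hL l' (by simp [hl'])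
    have ih' := ih hL'
    have hF := f_sub_x_ge hx L hL'
    obtain ⟨hp0, _, hw1, hwp⟩ := hadm
    have h1p : 0 < 1 - l.2 := by linarith
    rw [BD_cons, EFS_cons, zS_cons]
    show (1 - l.2) * zS[L] * ((BD[L, x]).1 + l.2 / (1 - l.2) * (BD[L, x]).2 - x) ≤
      l.2 * (EFS[L, x]).2 + (1 - l.2) * (EFS[L, x]).1 - x
    have hsimp : (1 - l.2) * zS[L] * ((BD[L, x]).1 + l.2 / (1 - l.2) * (BD[L, x]).2 - x) =
        l.2 * (zS[L] * (BD[L, x]).2) + (1 - l.2) * (zS[L] * ((BD[L, x]).1 - x)) := by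
      field_simp
      ring
    rw [hsimp]
    nlinarith

/-- **(B ≥ x)** for a nonempty admissible list with `p < 1` and `σS ≥ 1`: `B ≥ u₁·D(tail) ≥ u₁·(1 − w₁p₁) ≥ w₁ p₁ ≥ x`. [this work] -/
theorem b_ge_x (hx : 0 < x) (l : ℝ × ℝ) (L : List (ℝ × ℝ)) (hL : ∀ l' ∈ l :: L, Adm[x, l'] ∧ l'.2 < 1)
    (hσ : 1 ≤ σS[l :: L]) : x ≤ (BD[l :: L, x]).1 := by
  obtain ⟨hadm, hp1⟩ := hL l (by simp)
  have hL' : ∀ l' ∈ L, Adm[x, l'] ∧ l'.2 < 1 := fun l' hl' => hL l' (by simp [hl'])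
  obtain ⟨hB', hDσ, hD'⟩ := BD_bounds hx L hL'
  obtain ⟨hp0, _, hw1, hwp⟩ := hadm
  have h1p : 0 < 1 - l.2 := by linarith
  rw [σS_cons] at hσ
  rw [BD_cons]
  show x ≤ (BD[L, x]).1 + l.2 / (1 - l.2) * (BD[L, x]).2
  have hu0 : 0 ≤ l.2 / (1 - l.2) := div_nonneg hp0 h1p.le
  -- `u·D' ≥ u·(1 − w p)` and `u (1 − w p) ≥ w p`
  have h1 : l.2 / (1 - l.2) * (1 - l.1 * l.2) ≤ l.2 / (1 - l.2) * (BD[L, x]).2 :=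
    mul_le_mul_of_nonneg_left (by linarith) hu0
  have h2 : l.1 * l.2 ≤ l.2 / (1 - l.2) * (1 - l.1 * l.2) := by
    rw [div_mul_eq_mul_div, le_div_iff₀ h1p]
    nlinarith
  linarith

/-- **Regime `σ ≥ 1` (N17 Step 2b).**  Admissible items (`0 ≤ p ≤ 1`, `w ≤ 1`, `x ≤ w p`) with `Σ w p ≥ 1` give `E W ≥ x`:
the second occurring weight (or `x` if exactly one item occurs) has mean at least `x`. [this work] -/
theorem ew_ge_of_sigma_ge_one (hx : 0 < x) (L : List (ℝ × ℝ)) (hL : ∀ l ∈ L, Adm[x, l]) (hσ : 1 ≤ σS[L]) :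
    x ≤ (EFS[L, x]).1 := by
  have hL0 : ∀ l ∈ L, 0 ≤ l.2 ∧ l.2 ≤ 1 ∧ x ≤ l.1 :=
    fun l hl => ⟨(hL l hl).1, (hL l hl).2.1, (adm_bounds hx (hL l hl)).2.1⟩
  by_cases hsure : ∃ l ∈ L, l.2 = 1
  · obtain ⟨l, hl, hp⟩ := hsure
    have h0 := ew_ge_x_mul hx.le L hL0
    rw [zS_eq_zero_of_mem L hl hp] at h0
    linarith
  · push Not at hsure
    have hL' : ∀ l ∈ L, Adm[x, l] ∧ l.2 < 1 := fun l hl => ⟨hL l hl, lt_of_le_of_ne (hL l hl).2.1 (hsure l hl)⟩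
    cases L with
    | nil => simp at hσ; linarith
    | cons l L =>
      have hB := b_ge_x hx l L hL' hσ
      have hE := ew_sub_x_ge hx (l :: L) hL'
      have hz := zS_bounds (l :: L) (fun l' hl' => ⟨(hL' l' hl').1.1, (hL' l' hl').1.2.1⟩)
      nlinarith [hz.1]
end SecondWeight

end Quant

end Summit.CriticalPhenomena.PercolationContinuityZ3.Theorems
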